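import Summits.ABC.IUTFork.Repair.RHHullCapacityNecessaryAnti
import Summits.ABC.IUTFork.Repair.RHQ3LTail
import HarnessLib

/-!
# R-H row 3 «hull-capacity-necessary» — `RHHullCapacityNecessaryBracket`: the TYPE-FREE closed index of the [ED] cell. At every place of every
# pilot datum the boundary label of Σ₃ is `I` or `I + 1`, `I := ⌊(d + a + b + c)/μ⌋₊` — the slice bracket `β_w ∈ {0,1}` with the TRUE different

PROOF-ONLY file of the abc-iut cell (D-0079 RESCUE sub-cell R-H, rung LADDER-ABC:A2.RESCUE.H; seat abc-iut-rh-typ-3 gen 5, the row-3 typer of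
record). TAKES NO SIDE on [IUTchIII] Cor. 3.12 or on any author; nothing here asserts abc; H⋆₃ / its cells are HYPOTHESES about OUR typed objects
(`RHHullCapacityNecessaryTyped.CellAt` p458118, Σ₃ = `RH.SigmaStrataEq.sigmaED` p470530), read BY NAME; a cell that «holds» means only that
abc-iut-w4-d092's explicit-depth refuting engine is SILENT there.

WHAT IT ADDS to `RHHullCapacityNecessaryAnti` (p479453: the cell is antitone in the label, all local types) and to abc-iut-rh2-q3-typ-1's linear
sandwich `RH.Q3LTail.cellAt_of_linear` / `not_cellAt_of_linear` (p470687; the two tests are ONE UNIT of `(j−1)μ` apart, i.e. up to `1/μ` labels).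
With `μ := P_q(x₀)/e(x₀|p)`, `κ := d + a + b + c` (the TRUE different exponent `d` of `K_{x₀}`, [IUTchIV] Prop. 1.2 radii `a, b`, `c = ord_p(2p)`)
and the natural number `I := ⌊κ/μ⌋₊`:
* `one_le_depthCapacity` — `κ ≥ 1` (q3-typ-1's `depth_constants_ge` at `t = 0`, cited);
* **`cellAt_of_le_floorIdx`** — `i₀ ≤ I ⟹` cell (any `μ ≥ 0`); **`not_cellAt_of_floorIdx_add_two_le`** — `μ > 0 ∧ I + 2 ≤ i₀ ⟹` NO cell. The gap
  between the two is the SINGLE label `I + 1`: **`cellAt_iff_le_floorIdx_of_ne`** — for `i₀ ≠ I + 1`, cell ⟺ `i₀ ≤ I`. So the last label of the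
  initial segment Σ₃ ∩ (place) is `I` or `I + 1` (∧ `l⋆ − 1`): `plan/rescue/R-H/SLICE.md` row 3's bracket `j_c ≤ j₀ ≤ j_c + 1`, `j_c = I + 1`,
  proved there (p475844 `closedSuff_iff_le` / `closedSuff_of_intCell_succ`) only for `p` odd, `p ∤ e` with `d = (e−1)/e`; here for EVERY local
  type with the true `d` (tame check: `κ/μ = (e(B+2)+A−2)/m`, the SLICE closed form). The proof of the upper end needs only `κ ≥ 1`:
  at `i₀ ≥ I + 2` the floor-free margin `(i₀+2)(i₀μ − κ) > (I+4)μ > κ + 3μ > 1` beats the unit lost to the floor.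
* `qPilot_div_ramIdx_pos_of_mem` — `μ > 0` at a bad place; bad-place forms `cellAt_iff_le_floorIdx_of_mem_of_ne`, and the Σ₃ readings
  `mem_sigmaED_of_forall_le_floorIdx` / `not_mem_sigmaED_of_floorIdx_add_two_le`.
[cite: Mochizuki2012, IUTchIV Prop. 1.1 p. 9, Prop. 1.2 (i)(ii) p. 10; IUTchI Ex. 3.2 (iv) p. 71] [cite: DupuyHilado2025, §3.3]
[claim: Mochizuki2012, status: disputed] for every IUT locution. typed ≠ proved; locator ≠ «S holds».
-/

noncomputable section

open Set Function NumberField IsDedekindDomain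
open scoped Pointwise

namespace Summit.ABC.IUTFork.Repair.RHHullCapacityNecessaryBracket

open Literature.AnabelianGeometry.AbsoluteAnabelian Literature.IUT.LogThetaLattice Literature.IUT.LogVolume
  Literature.IUT.HodgeTheaters Literature.NumberTheory.NumberFields Literature.NumberTheory.GaloisRepresentations.Ultrametric
open Summit.ABC.IUTFork.Thm311 Summit.ABC.IUTFork.Thm311.Real Summit.ABC.IUTFork.Cor312 Summit.ABC.IUTFork.Cor312.Setting
  Summit.ABC.IUTFork.Cor312Vol Summit.ABC.IUTFork.Cor312Vol.ExplicitDepth Summit.ABC.IUTFork.Cor312Prov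
  Summit.ABC.IUTFork.Repair.RHHullCapacityNecessaryTyped Summit.ABC.IUTFork.Repair.RHHullCapacityNecessaryAnti
  Summit.ABC.IUTFork.Repair.RH.SigmaStrataEq Summit.ABC.IUTFork.Repair.RH.Q3LTail

/-! ## §1. Real arithmetic: beyond `I + 2` the floor-cell fails as soon as the capacity is `≥ 1` -/

/-- **Upper end of the bracket, arithmetic core.** For `μ > 0`, `κ ≥ 1` and a natural `i` with `⌊κ/μ⌋₊ + 2 ≤ i`, split `κ = δ + β` arbitrarily:
then `μ + (i+2)β < ⌊(i+1)²μ − (i+2)δ⌋`, i.e. the [ED] floor inequality FAILS. (`⌊κ/μ⌋₊·μ > κ − μ`, so `iμ − κ > μ` and the floor-free margin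
`(i+2)(iμ − κ) > (i+2)μ ≥ (⌊κ/μ⌋₊ + 4)μ > κ + 3μ > 1`.) [folklore] -/
theorem lt_floor_of_floorIdx_add_two_le {μ κ δ β : ℝ} (hμ : 0 < μ) (hκ : 1 ≤ κ) (hsplit : κ = δ + β) {i : ℕ} (hi : ⌊κ / μ⌋₊ + 2 ≤ i) :
    μ + ((i : ℝ) + 2) * β < (⌊((i : ℝ) + 1) ^ 2 * μ - ((i : ℝ) + 2) * δ⌋ : ℝ) := by
  have hκμ : 0 ≤ κ / μ := div_nonneg (by linarith) hμ.le
  have hI : κ / μ < (⌊κ / μ⌋₊ : ℝ) + 1 := Nat.lt_floor_add_one _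
  have hiR : (⌊κ / μ⌋₊ : ℝ) + 2 ≤ i := by exact_mod_cast hi
  -- `I·μ > κ − μ`
  have hIμ : κ - μ < (⌊κ / μ⌋₊ : ℝ) * μ := by
    have := mul_lt_mul_of_pos_right hI hμ
    rw [div_mul_cancel₀ κ hμ.ne'] at this
    linarith
  -- `i·μ − κ > μ` and `(i+2)·μ > κ + 3μ ≥ 1 + 3μ`
  have h1 : μ < (i : ℝ) * μ - κ := by nlinarith
  have h2 : κ + 3 * μ < ((i : ℝ) + 2) * μ := by nlinarith
  have hmargin : 1 < ((i : ℝ) + 2) * ((i : ℝ) * μ - κ) := by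
    have h3 : ((i : ℝ) + 2) * μ ≤ ((i : ℝ) + 2) * ((i : ℝ) * μ - κ) :=
      mul_le_mul_of_nonneg_left h1.le (by positivity)
    nlinarith
  have hfl := Int.lt_floor_add_one (((i : ℝ) + 1) ^ 2 * μ - ((i : ℝ) + 2) * δ)
  have hexp : ((i : ℝ) + 1) ^ 2 * μ - ((i : ℝ) + 2) * δ - (μ + ((i : ℝ) + 2) * β) = ((i : ℝ) + 2) * ((i : ℝ) * μ - κ) := by
    rw [hsplit]; ring
  linarith

/-! ## §2. The bracket at a place of a pilot datum — any prime, any local type -/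

section Cells

variable {F : Type} [Field F] [NumberField F] (X : PilotData F) {logv : PadicLogs F} (hlog : LogvAnalytic logv)

/-- **`κ = d + a + b + c ≥ 1`** for every `p`-adic field — abc-iut-rh2-q3-typ-1's `RH.Q3LTail.depth_constants_ge` (p470687) at `t = 0`
(`p⁰ = 1 ≤ e` by `absRamificationIdx_pos`). [cite: Mochizuki2012, IUTchIV Prop. 1.1 p. 9, Prop. 1.2 p. 10] [claim: Mochizuki2012, status: disputed] -/
theorem one_le_depthCapacity (p : ℕ) [hp : Fact p.Prime] (K₀ : Type) [NontriviallyNormedField K₀] [NormedAlgebra ℚ_[p] K₀]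
    [IsUltrametricDist K₀] [ProperSpace K₀] :
    1 ≤ differentOrd p K₀ + logRadiusA p (absRamificationIdx p K₀) + logRadiusB p (absRamificationIdx p K₀)
      + (((if p = 2 then 2 else 1 : ℕ)) : ℝ) := by
  have he : p ^ 0 ≤ absRamificationIdx p K₀ := by rw [pow_zero]; exact absRamificationIdx_pos p K₀
  have h := depth_constants_ge p K₀ he
  simpa using h

/-- **`μ = P_q(x₀)/e(x₀|p) > 0` AT A BAD PLACE** (`P_q(v) = ord_v(q_v)/(2l) > 0` on `S`, `e(v|p) ≥ 1`). [cite: DupuyHilado2025, §3.3] -/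
theorem qPilot_div_ramIdx_pos_of_mem {v : HeightOneSpectrum (𝓞 F)} (hv : v ∈ X.S) : 0 < X.qPilot v / (ramIdx F v : ℝ) := by
  apply div_pos
  · rw [X.qPilot_apply_of_mem hv]
    exact div_pos (by exact_mod_cast X.ordq_pos hv) X.two_mul_l_pos
  · exact_mod_cast Nat.pos_of_ne_zero (ramIdx_ne_zero F v)

/-- **LOWER END: `i₀ ≤ I ⟹` the cell holds**, `I := ⌊(d+a+b+c)/μ⌋₊` (q3-typ-1's linear sufficient test `cellAt_of_linear` in index form; at
`μ = 0` — a good place — every cell holds anyway). [cite: Mochizuki2012, IUTchIV Prop. 1.2 (i)(ii) p. 10] [claim: Mochizuki2012, status: disputed] -/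
theorem cellAt_of_le_floorIdx (pp : Nat.Primes) (i₀ : Fin (thetaIndex X).lstar) (x₀ : (thetaIndex X).Fibre (.inr pp))
    (hi : haveI : Fact (pp : ℕ).Prime := ⟨pp.2⟩
      (i₀ : ℕ) ≤ ⌊(differentOrd (pp : ℕ) (kOf X pp.1 x₀) + logRadiusA (pp : ℕ) (absRamificationIdx (pp : ℕ) (kOf X pp.1 x₀))
          + logRadiusB (pp : ℕ) (absRamificationIdx (pp : ℕ) (kOf X pp.1 x₀)) + (((if (pp : ℕ) = 2 then 2 else 1 : ℕ)) : ℝ)) /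
        (X.qPilot (placeOf X pp.1 x₀) / (ramIdx F (placeOf X pp.1 x₀) : ℝ))⌋₊) :
    CellAt X hlog pp i₀ x₀ := by
  haveI hF : Fact (pp : ℕ).Prime := ⟨pp.2⟩
  set μ : ℝ := X.qPilot (placeOf X pp.1 x₀) / (ramIdx F (placeOf X pp.1 x₀) : ℝ) with hμ
  set κ : ℝ := differentOrd (pp : ℕ) (kOf X pp.1 x₀) + logRadiusA (pp : ℕ) (absRamificationIdx (pp : ℕ) (kOf X pp.1 x₀))
      + logRadiusB (pp : ℕ) (absRamificationIdx (pp : ℕ) (kOf X pp.1 x₀)) + (((if (pp : ℕ) = 2 then 2 else 1 : ℕ)) : ℝ) with hκ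
  have hκ1 : 1 ≤ κ := one_le_depthCapacity (pp : ℕ) (kOf X pp.1 x₀)
  have hμ0 : 0 ≤ μ := qPilot_div_ramIdx_nonneg X (placeOf X pp.1 x₀)
  apply cellAt_of_linear X hlog pp i₀ x₀
  show ((i₀ : ℕ) : ℝ) * μ ≤ κ
  rcases hμ0.eq_or_lt with h0 | hpos
  · rw [← h0, mul_zero]; linarith
  · have hiR : ((i₀ : ℕ) : ℝ) ≤ (⌊κ / μ⌋₊ : ℝ) := by exact_mod_cast hi
    have hfl : (⌊κ / μ⌋₊ : ℝ) ≤ κ / μ := Nat.floor_le (div_nonneg (by linarith) hpos.le)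
    rw [← le_div_iff₀ hpos]
    linarith

/-- **UPPER END: `μ > 0 ∧ I + 2 ≤ i₀ ⟹` the cell FAILS**, `I := ⌊(d+a+b+c)/μ⌋₊` — one label above the linear test, because the capacity
`κ = d+a+b+c ≥ 1` outweighs the unit the floor can lose (`lt_floor_of_floorIdx_add_two_le`). Sharper than the linear refuting test
`not_cellAt_of_linear` (`κ + 1 ≤ i₀μ`, up to `1/μ` labels higher). [cite: Mochizuki2012, IUTchIV Prop. 1.2 (i)(ii) p. 10] [claim: Mochizuki2012, status: disputed] -/
theorem not_cellAt_of_floorIdx_add_two_le (pp : Nat.Primes) (i₀ : Fin (thetaIndex X).lstar) (x₀ : (thetaIndex X).Fibre (.inr pp))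
    (hμ : haveI : Fact (pp : ℕ).Prime := ⟨pp.2⟩; 0 < X.qPilot (placeOf X pp.1 x₀) / (ramIdx F (placeOf X pp.1 x₀) : ℝ))
    (hi : haveI : Fact (pp : ℕ).Prime := ⟨pp.2⟩
      ⌊(differentOrd (pp : ℕ) (kOf X pp.1 x₀) + logRadiusA (pp : ℕ) (absRamificationIdx (pp : ℕ) (kOf X pp.1 x₀))
          + logRadiusB (pp : ℕ) (absRamificationIdx (pp : ℕ) (kOf X pp.1 x₀)) + (((if (pp : ℕ) = 2 then 2 else 1 : ℕ)) : ℝ)) /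
        (X.qPilot (placeOf X pp.1 x₀) / (ramIdx F (placeOf X pp.1 x₀) : ℝ))⌋₊ + 2 ≤ (i₀ : ℕ)) :
    ¬ CellAt X hlog pp i₀ x₀ := by
  haveI hF : Fact (pp : ℕ).Prime := ⟨pp.2⟩
  rw [cellAt_iff_floor_le, not_le]
  set μ : ℝ := X.qPilot (placeOf X pp.1 x₀) / (ramIdx F (placeOf X pp.1 x₀) : ℝ) with hμdef
  set d : ℝ := differentOrd (pp : ℕ) (kOf X pp.1 x₀) with hd
  set a : ℝ := logRadiusA (pp : ℕ) (absRamificationIdx (pp : ℕ) (kOf X pp.1 x₀)) with ha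
  set b : ℝ := logRadiusB (pp : ℕ) (absRamificationIdx (pp : ℕ) (kOf X pp.1 x₀)) with hb
  set c : ℝ := (((if (pp : ℕ) = 2 then 2 else 1 : ℕ)) : ℝ) with hc
  have hκ1 : 1 ≤ d + a + b + c := one_le_depthCapacity (pp : ℕ) (kOf X pp.1 x₀)
  have key := lt_floor_of_floorIdx_add_two_le (δ := d + a) (β := c + b) hμ hκ1 (by ring) hi
  have e1 : ((((i₀ : ℕ) + 1 : ℕ) : ℝ)) = ((i₀ : ℕ) : ℝ) + 1 := by push_cast; ring
  rw [e1]
  exact key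

/-- **THE BRACKET (exact decider off one label)**: for `μ > 0` and every label `i₀ ≠ I + 1`, the [ED] cell holds IFF `i₀ ≤ I`
(`I = ⌊(d+a+b+c)/μ⌋₊`); hence the last label of the initial segment Σ₃ ∩ (place `x₀`) is `I` or `I + 1` (capped at `l⋆ − 1`) — SLICE.md row 3's
`j_c ≤ j₀ ≤ j_c + 1`, `j_c = I + 1`, now at EVERY local type with the TRUE different exponent `d`. (Tame check, `p` odd, `p ∤ e`:
`d = (e−1)/e`, `a = A/e`, `b = B − 1/e`, `c = 1`, `μ = m/e` give `κ/μ = (e(B+2)+A−2)/m`, the closed form of p463493/p475844.)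
[cite: Mochizuki2012, IUTchIV Prop. 1.2 (i)(ii) p. 10] [claim: Mochizuki2012, status: disputed] -/
theorem cellAt_iff_le_floorIdx_of_ne (pp : Nat.Primes) (i₀ : Fin (thetaIndex X).lstar) (x₀ : (thetaIndex X).Fibre (.inr pp))
    (hμ : haveI : Fact (pp : ℕ).Prime := ⟨pp.2⟩; 0 < X.qPilot (placeOf X pp.1 x₀) / (ramIdx F (placeOf X pp.1 x₀) : ℝ))
    (hne : haveI : Fact (pp : ℕ).Prime := ⟨pp.2⟩
      (i₀ : ℕ) ≠ ⌊(differentOrd (pp : ℕ) (kOf X pp.1 x₀) + logRadiusA (pp : ℕ) (absRamificationIdx (pp : ℕ) (kOf X pp.1 x₀))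
          + logRadiusB (pp : ℕ) (absRamificationIdx (pp : ℕ) (kOf X pp.1 x₀)) + (((if (pp : ℕ) = 2 then 2 else 1 : ℕ)) : ℝ)) /
        (X.qPilot (placeOf X pp.1 x₀) / (ramIdx F (placeOf X pp.1 x₀) : ℝ))⌋₊ + 1) :
    haveI : Fact (pp : ℕ).Prime := ⟨pp.2⟩
    CellAt X hlog pp i₀ x₀ ↔
      (i₀ : ℕ) ≤ ⌊(differentOrd (pp : ℕ) (kOf X pp.1 x₀) + logRadiusA (pp : ℕ) (absRamificationIdx (pp : ℕ) (kOf X pp.1 x₀))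
          + logRadiusB (pp : ℕ) (absRamificationIdx (pp : ℕ) (kOf X pp.1 x₀)) + (((if (pp : ℕ) = 2 then 2 else 1 : ℕ)) : ℝ)) /
        (X.qPilot (placeOf X pp.1 x₀) / (ramIdx F (placeOf X pp.1 x₀) : ℝ))⌋₊ := by
  haveI hF : Fact (pp : ℕ).Prime := ⟨pp.2⟩
  constructor
  · intro h
    by_contra hgt
    rw [not_le] at hgt
    exact not_cellAt_of_floorIdx_add_two_le X hlog pp i₀ x₀ hμ (by omega) h
  · exact cellAt_of_le_floorIdx X hlog pp i₀ x₀

/-- Bad-place form of the bracket (`μ > 0` is automatic at `x₀ ∈ S`). [claim: Mochizuki2012, status: disputed] -/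
theorem cellAt_iff_le_floorIdx_of_mem_of_ne (pp : Nat.Primes) (i₀ : Fin (thetaIndex X).lstar) (x₀ : (thetaIndex X).Fibre (.inr pp))
    (hx : haveI : Fact (pp : ℕ).Prime := ⟨pp.2⟩; placeOf X pp.1 x₀ ∈ X.S)
    (hne : haveI : Fact (pp : ℕ).Prime := ⟨pp.2⟩
      (i₀ : ℕ) ≠ ⌊(differentOrd (pp : ℕ) (kOf X pp.1 x₀) + logRadiusA (pp : ℕ) (absRamificationIdx (pp : ℕ) (kOf X pp.1 x₀))
          + logRadiusB (pp : ℕ) (absRamificationIdx (pp : ℕ) (kOf X pp.1 x₀)) + (((if (pp : ℕ) = 2 then 2 else 1 : ℕ)) : ℝ)) /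
        (X.qPilot (placeOf X pp.1 x₀) / (ramIdx F (placeOf X pp.1 x₀) : ℝ))⌋₊ + 1) :
    haveI : Fact (pp : ℕ).Prime := ⟨pp.2⟩
    CellAt X hlog pp i₀ x₀ ↔
      (i₀ : ℕ) ≤ ⌊(differentOrd (pp : ℕ) (kOf X pp.1 x₀) + logRadiusA (pp : ℕ) (absRamificationIdx (pp : ℕ) (kOf X pp.1 x₀))
          + logRadiusB (pp : ℕ) (absRamificationIdx (pp : ℕ) (kOf X pp.1 x₀)) + (((if (pp : ℕ) = 2 then 2 else 1 : ℕ)) : ℝ)) /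
        (X.qPilot (placeOf X pp.1 x₀) / (ramIdx F (placeOf X pp.1 x₀) : ℝ))⌋₊ :=
  cellAt_iff_le_floorIdx_of_ne X hlog pp i₀ x₀ (by
    haveI : Fact (pp : ℕ).Prime := ⟨pp.2⟩
    exact qPilot_div_ramIdx_pos_of_mem X hx) hne

end Cells

/-! ## §3. Reading on Σ₃ (`RH.SigmaStrataEq.sigmaED`): a prime cell is IN below every bad place's index, OUT two above any one of them -/

section Sigma

variable {F : Type} [Field F] [NumberField F] (X : PilotData F) {logv : PadicLogs F} (hlog : LogvAnalytic logv)

/-- **`(i, p) ∈ Σ₃` as soon as `i ≤ I(x₀)` at EVERY bad `x₀ | p`.** [claim: Mochizuki2012, status: disputed] -/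
theorem mem_sigmaED_of_forall_le_floorIdx (pp : Nat.Primes) (i : Fin (thetaIndex X).lstar)
    (h : ∀ x₀ : (thetaIndex X).Fibre (.inr pp), (haveI : Fact (pp : ℕ).Prime := ⟨pp.2⟩; placeOf X pp.1 x₀ ∈ X.S) →
      haveI : Fact (pp : ℕ).Prime := ⟨pp.2⟩
      (i : ℕ) ≤ ⌊(differentOrd (pp : ℕ) (kOf X pp.1 x₀) + logRadiusA (pp : ℕ) (absRamificationIdx (pp : ℕ) (kOf X pp.1 x₀))
          + logRadiusB (pp : ℕ) (absRamificationIdx (pp : ℕ) (kOf X pp.1 x₀)) + (((if (pp : ℕ) = 2 then 2 else 1 : ℕ)) : ℝ)) /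
        (X.qPilot (placeOf X pp.1 x₀) / (ramIdx F (placeOf X pp.1 x₀) : ℝ))⌋₊) :
    ((i, Sum.inr pp) : Fin (thetaIndex X).lstar × (thetaIndex X).VQ) ∈ sigmaED X hlog := by
  intro qq hqq x₀ hx
  obtain rfl : pp = qq := Sum.inr_injective hqq
  exact cellAt_of_le_floorIdx X hlog pp i x₀ (h x₀ hx)

/-- **`(i, p) ∉ Σ₃` as soon as `I(x₀) + 2 ≤ i` at SOME bad `x₀ | p`.** [claim: Mochizuki2012, status: disputed] -/
theorem not_mem_sigmaED_of_floorIdx_add_two_le (pp : Nat.Primes) (i : Fin (thetaIndex X).lstar) (x₀ : (thetaIndex X).Fibre (.inr pp))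
    (hx : haveI : Fact (pp : ℕ).Prime := ⟨pp.2⟩; placeOf X pp.1 x₀ ∈ X.S)
    (hi : haveI : Fact (pp : ℕ).Prime := ⟨pp.2⟩
      ⌊(differentOrd (pp : ℕ) (kOf X pp.1 x₀) + logRadiusA (pp : ℕ) (absRamificationIdx (pp : ℕ) (kOf X pp.1 x₀))
          + logRadiusB (pp : ℕ) (absRamificationIdx (pp : ℕ) (kOf X pp.1 x₀)) + (((if (pp : ℕ) = 2 then 2 else 1 : ℕ)) : ℝ)) /
        (X.qPilot (placeOf X pp.1 x₀) / (ramIdx F (placeOf X pp.1 x₀) : ℝ))⌋₊ + 2 ≤ (i : ℕ)) :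
    ((i, Sum.inr pp) : Fin (thetaIndex X).lstar × (thetaIndex X).VQ) ∉ sigmaED X hlog :=
  not_mem_sigmaED_of_not_cellAt X hlog pp i x₀ hx
    (not_cellAt_of_floorIdx_add_two_le X hlog pp i x₀ (by
      haveI : Fact (pp : ℕ).Prime := ⟨pp.2⟩
      exact qPilot_div_ramIdx_pos_of_mem X hx) hi)

end Sigma

end Summit.ABC.IUTFork.Repair.RHHullCapacityNecessaryBracket

end
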